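import Mathlib
import Summits.ValiantsHypothesis.ValiantsHypothesis.Theses.DivisionGap

/-!
# Sketch (crux-ideate, ideator 2, round 1) — crux `PerDivisionHard` (stmt-ValiantsHypothesis-5065)

First-lemma signatures of the two idea cards `birkhoff-face-descent` and
`typed-vertex-rectangles`.  Nothing here is proved; the file only has to elaborate.
-/

noncomputable section

namespace Summit.ValiantsHypothesis.ValiantsHypothesis.Cruxes.PerDivisionHard.Ideator2

open scoped BigOperators
open MvPolynomial
open Literature.Computability.AlgebraicComplexity

/-! ## Card `birkhoff-face-descent` -/

/-- Torus homogeneity of a polynomial in the matrix variables `x_{ij}`: all its monomials have the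
same row margins `r` and the same column margins `cc` (it is a semi-invariant of the torus
`(ℝ_{>0})ⁿ × (ℝ_{>0})ⁿ`, `x_{ij} ↦ s_i t_j x_{ij}`). -/
def IsTorusHomogeneous {n : ℕ} (h : MvPolynomial (Fin n × Fin n) NNReal) : Prop :=
  ∃ r cc : Fin n → ℕ, ∀ m ∈ h.support, (∀ i, ∑ j, m (i, j) = r i) ∧ (∀ j, ∑ i, m (i, j) = cc j)

/-- FIRST LEMMA (A1, "weighted envelopes are free"): over `ℝ≥0` the leading form of `f` for any
`ℕ`-weighting of the variables is computed by the same circuit with some sum-operands dropped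
(Jerrum–Snir 1982 Thm 2.4 = Jukna, Tropical Circuit Complexity, Lemma 1.32, there for the total
degree; the proof is weight-agnostic). -/
theorem complexity_leadingForm_le {σ : Type} [DecidableEq σ] (w : σ → ℕ)
    (f : MvPolynomial σ NNReal) :
    complexity (weightedHomogeneousComponent w (weightedTotalDegree w f) f) ≤ complexity f := by
  sorry

/-- The sub-permanent of a bipartite "face" `E ⊆ [n]²`: sum over the perfect matchings inside `E`
(column-major like `perPoly`: the monomial of `σ` is `∏ i, X (σ i, i)`).  It is the leading form
of `perPoly` for the weight `1_E` whenever `E` contains a perfect matching. -/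
def facePer {n : ℕ} (E : Finset (Fin n × Fin n)) : MvPolynomial (Fin n × Fin n) NNReal :=
  ∑ σ ∈ (Finset.univ : Finset (Equiv.Perm (Fin n))).filter (fun σ => ∀ i, (σ i, i) ∈ E),
    ∏ i, X (σ i, i)

/-- A2–A4 (face descent): a cheap pair `(per·h, h)` descends to every face `E` of the Birkhoff
polytope that contains a perfect matching, the cofactor being replaced by a nonzero
torus-homogeneous polynomial supported on the variables of `E`, at no cost. -/
def FaceDescent : Prop :=
  ∀ (n : ℕ) (E : Finset (Fin n × Fin n)) (h : MvPolynomial (Fin n × Fin n) NNReal), h ≠ 0 →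
    (∃ σ : Equiv.Perm (Fin n), ∀ i, (σ i, i) ∈ E) →
    ∃ h' : MvPolynomial (Fin n × Fin n) NNReal, h' ≠ 0 ∧ IsTorusHomogeneous h' ∧
      (∀ m ∈ h'.support, ∀ e ∉ E, m e = 0) ∧
      complexity (facePer E * h') + complexity h' ≤
        complexity (perPoly (Fin n) NNReal * h) + complexity h

/-- TRANSFER `C⁺` of card A: the crux for torus-homogeneous cofactors only. -/
def TorusHomogeneousPerDivisionHard : Prop :=
  ∀ c : ℕ, ∃ n₀ : ℕ, ∀ n ≥ n₀, ∀ h : MvPolynomial (Fin n × Fin n) NNReal, h ≠ 0 →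
    IsTorusHomogeneous h →
    2 ^ ((Nat.log 2 n + c) ^ c) <
      complexity (perPoly (Fin n) NNReal * h) + complexity h

/-- `C⁺ → crux` (by A1–A2 with `E = [n]²`: same `n`, same threshold). -/
theorem perDivisionHard_of_torusHomogeneous :
    TorusHomogeneousPerDivisionHard →
      Summit.ValiantsHypothesis.ValiantsHypothesis.Theses.DivisionGap.PerDivisionHard := by
  sorry

/-- A5 (kill criterion, monomial cofactors): if the descended cofactor is a monomial the pair is
as expensive as the face permanent up to the reciprocal-input simulation
(Jukna, Tropical Circuit Complexity, Thm 6.11 / Rem 6.19: `(+,×,1/xᵢ)`-size `s` ⇒ `(+,×)`-size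
`O(N s²)`, `N = n²` variables). -/
def MonomialCofactorRung : Prop :=
  ∃ C : ℕ, ∀ (n : ℕ) (E : Finset (Fin n × Fin n)) (β : (Fin n × Fin n) →₀ ℕ),
    complexity (facePer E) ≤
      C * n ^ 2 * (complexity (facePer E * monomial β 1) + n ^ 2 * Nat.log 2 (β.degree + 2)) ^ 2

/-! ## Card `typed-vertex-rectangles` -/

/-- FIRST LEMMA (B1, PerPowersHard, claimed with a complete half-page proof in the card):
every power of the permanent has monotone complexity at least `C(n, ⌈n/3⌉)`, uniformly in the
exponent. -/
theorem choose_le_complexity_perPoly_pow (n M : ℕ) (hn : 3 ≤ n) (hM : 1 ≤ M) :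
    Nat.choose n ((n + 2) / 3) ≤ complexity ((perPoly (Fin n) NNReal) ^ M) := by
  sorry

/-- B2: the rung `h = per^{M}` (all `M`, the cofactor charged or not) of the crux. -/
theorem perDivisionHard_powers :
    ∀ c : ℕ, ∃ n₀ : ℕ, ∀ n ≥ n₀, ∀ M : ℕ,
      2 ^ ((Nat.log 2 n + c) ^ c) <
        complexity (perPoly (Fin n) NNReal * perPoly (Fin n) NNReal ^ M) +
          complexity (perPoly (Fin n) NNReal ^ M) := by
  sorry

/-- B3 (the typed vertex bound for an arbitrary torus-homogeneous cofactor): writing `Pure h` for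
the monomials of `h` supported on a partial matching and `PureOn π h` for those supported inside
the perfect matching `π`, every monotone circuit for `per·h` has at least
`(Σ_{A ∈ Pure h} (n − #rows A)!) / (⌈n/3⌉!·⌊2n/3⌋!·max_π #PureOn π h)` gates.  Stated here in the
clean special case `max_π #PureOn π h ≤ 1` and all pure monomials touching every row. -/
def TypedVertexBound : Prop :=
  ∀ (n : ℕ), 3 ≤ n → ∀ (h : MvPolynomial (Fin n × Fin n) NNReal), IsTorusHomogeneous h →
    (∀ σ : Equiv.Perm (Fin n),
      ((h.support.filter fun A => ∀ e, A e ≠ 0 → e.1 = σ e.2).card ≤ 1)) →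
    ((h.support.filter fun A =>
        (∃ σ : Equiv.Perm (Fin n), ∀ e, A e ≠ 0 → e.1 = σ e.2) ∧ ∀ j, ∃ i, A (i, j) ≠ 0).card
      * Nat.choose n ((n + 2) / 3) : ℕ) ≤
      (n.factorial : ℕ) * complexity (perPoly (Fin n) NNReal * h)

end Summit.ValiantsHypothesis.ValiantsHypothesis.Cruxes.PerDivisionHard.Ideator2
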